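import Literature.NumberTheory.Sieve.DivisorBound
import HarnessLib

/-!
# The Chebyshev–Hooley moduli sequence of `ℓ² + 1`: empty rows in bilinear forms

Part of the `SoloInformed*` obstruction series for `Summit.Parity.BatemanHorn` (the conjunct
`BatemanHorn` with `k = 1`, `f = X² + 1`, i.e. Landau / Hardy–Littlewood Conjecture E).

The only line of attack on `n² + 1` along which quantified progress exists is the
Chebyshev–Hooley method for the greatest prime factor: one studies the MODULI sequence
`c_X(k) = #{1 ≤ ℓ ≤ X : k ∣ ℓ² + 1}` at a level `k ≍ K = X^α`, `1 ≤ α ≤ 2`, against its model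
`b(k) = X · ρ(k)/k` (`ρ(k) = #{ν mod k : ν² + 1 ≡ 0}`), through "Type I" sums (moduli in
progressions) and "Type II" sums `∑_{m ∼ M} ∑_{n ∼ N} α_m β_n (c_X(mn) − b(mn))`, `MN = K`
(Hooley 1967, Deshouillers–Iwaniec 1982, de la Bretèche–Drappeau 2020, Merikoski 2023,
Pascadi 2024, Grimmelt–Merikoski 2025: `P⁺(n²+1) > n^{1.312}` [arXiv:2505.00493, Theorem 1.1];
the Type-II estimate there, Theorem 1.5, assumes `M ≤ X`, `N ≤ M`, `MN ≥ X`).  Conjecture E is the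
top rung `α = 2` of this ladder (there `c_X(k) ≠ 0` forces `k ∈ {ℓ²+1, (ℓ²+1)/2, …}`: the moduli
sequence IS the value set).

This file proves the elementary obstruction that confines such bilinear information to the
window `X^{α−1−o(1)} ≤ M, N ≤ X^{1+o(1)}` — the analogue, for the moduli sequence, of the
thin-support theorems `SoloInformedThin*` for the value sequence:

* `bilinear_emptyRows_lower` — MODEL-FREE: for finite sets of rows `R` and columns `C`, any real
  `c` and any model `b ≥ 0` on the box with row sums `≤ ρ`, and any finite set `L` containing every
  row that meets the support of `c`, the `{0,1}`-valued row coefficient `β = 1_{R ∖ L}` (with column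
  coefficient `α ≡ 1`) gives `|∑_{n ∈ R} β_n ∑_{m ∈ C} (c(mn) − b(mn))| ≥ ∑_{R×C} b − #L · ρ`:
  a bilinear form with divisor-bounded (indeed `{0,1}`) coefficients that sees NO cancellation
  beyond the model mass carried by the live rows;
* `liveRow_subset` / `card_liveRows_le` — for `c = c_X` every live row `n` divides some
  `ℓ² + 1`, `ℓ ≤ X`, so `#L ≤ ∑_{ℓ ≤ X} τ(ℓ² + 1)` (`≤ C_ε X^{1+2ε}` by the divisor bound,
  `sum_card_divisors_sq_add_one_le`);
* `chebyshevHooley_rows`, `chebyshevHooley_rows_rpow` — the assembled statement for the moduli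
  sequence and an arbitrary non-negative model; `chebyshevHooley_cols` — the same with the roles
  of the two variables exchanged.

Reading (numbers, not adjectives).  Take `R = (N, 2N]`, `C = (M, 2M]`, `MN = K = X^α`, and the
Grimmelt–Merikoski model `b(k) = X ∫ψ · ρ(k)/k ≤ 2X τ(k)²/K` on the box (the tree's
`Literature.NumberTheory.Sieve.GM2025.rho_le_card_divisors_sq`), so `ρ ≤ #C · max b ≤ X^{1+o(1)}/N`
and `#L · ρ ≤ X^{2+o(1)}/N`.  Hence for `N ≥ X^{1+ε}` (equivalently `M ≤ X^{α−1−ε}`) NO estimate of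
the shape `|∑∑ α_m β_n (c_X(mn) − b(mn))| ≤ (model mass) · X^{−δ}` can hold for all
`1`-bounded coefficients, whatever arithmetic input is used: the hypothesis `M ≤ X` of
[arXiv:2505.00493, Theorem 1.5] (which forces `N = K/M ≥ X^{α−1}`) is necessary up to `X^{o(1)}`,
and by `chebyshevHooley_cols` so is `N ≤ X^{1+o(1)}`.  At the top rung `K ≍ X²` the window
`[X^{α−1}, X]` degenerates to the single balanced box `M ≍ N ≍ X`, where `c_X(mn) = 1` iff
`jmn − 1` is a square `≤ X²` for some `j ≤ 4` — the Type-II sum of the VALUE sequence `ℓ² + 1` at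
`θ = 1/2`, the one point the value-side theorems
(`eventually_not_typeII_polyGrowth_shortInterval_all` and its relatives) do not exclude and
Ford–Maynard's minimal-Type-II theorem (`Literature.Barriers.Parity.FordMaynardMinimalTypeII_holds`)
renders useless for lower bounds.
The model mass `∑_{R×C} b` itself is `≍ X` for `M, N → ∞` by the mean value of `ρ`
(tree: `Literature.NumberTheory.Sieve.abs_rhoSum_sub_main_le`); this file does not formalise that
benchmark and states every bound relative to it.

References: C. Hooley, Acta Math. 117 (1967); J.-M. Deshouillers, H. Iwaniec, Ann. Inst. Fourier
32 (1982); R. de la Bretèche, S. Drappeau, JEMS 22 (2020); J. Merikoski, JEMS 25 (2023)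
[arXiv:1908.08816, Prop. 4 and §4]; A. Pascadi [arXiv:2404.04239, Thm 1]; L. Grimmelt,
J. Merikoski [arXiv:2505.00493, Thms 1.1, 1.5]. [folklore] for everything proved here.
-/

noncomputable section

open Finset

namespace Summit.Parity.BatemanHorn.Theorems

/-! ### The model-free empty-rows test -/

/-- **Empty rows see no cancellation.**  Rows `R`, columns `C`, an arbitrary real sequence `c`
tested against a model `b` that is non-negative on the box with row sums at most `ρ ≥ 0`; `L` is
any finite set containing every row meeting the support of `c`.  Then the row coefficient
`β = 1_{∉ L}` (values in `{0,1}`; column coefficient `1`) produces a bilinear sum of modulus at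
least the total model mass minus `#L · ρ`. [folklore] -/
theorem bilinear_emptyRows_lower (R C L : Finset ℕ) (c b : ℕ → ℝ)
    (hb : ∀ n ∈ R, ∀ m ∈ C, 0 ≤ b (m * n)) {ρ : ℝ} (hρ : 0 ≤ ρ)
    (hrow : ∀ n ∈ R, ∑ m ∈ C, b (m * n) ≤ ρ)
    (hL : ∀ n ∈ R, ∀ m ∈ C, c (m * n) ≠ 0 → n ∈ L) :
    ∃ β : ℕ → ℝ, (∀ n, β n = 0 ∨ β n = 1) ∧
      (∑ n ∈ R, ∑ m ∈ C, b (m * n)) - (#L : ℝ) * ρ ≤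
        |∑ n ∈ R, β n * ∑ m ∈ C, (c (m * n) - b (m * n))| := by
  classical
  refine ⟨fun n => if n ∈ L then 0 else 1, fun n => by by_cases h : n ∈ L <;> simp [h], ?_⟩
  -- rows outside `L` are empty: every `c (m * n)` vanishes there
  have hempty : ∀ n ∈ R, n ∉ L → ∀ m ∈ C, c (m * n) = 0 := by
    intro n hn hnL m hm
    by_contra h
    exact hnL (hL n hn m hm h)
  -- the bilinear sum equals minus the model mass of the empty rows
  have hsum : ∑ n ∈ R, (if n ∈ L then (0 : ℝ) else 1) * ∑ m ∈ C, (c (m * n) - b (m * n)) =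
      -∑ n ∈ R.filter (fun n => n ∉ L), ∑ m ∈ C, b (m * n) := by
    rw [← sum_neg_distrib, sum_filter]
    refine sum_congr rfl fun n hn => ?_
    by_cases h : n ∈ L
    · simp [h]
    · simp only [h, if_false, one_mul, not_false_eq_true, if_true]
      rw [← sum_neg_distrib]
      refine sum_congr rfl fun m hm => ?_
      rw [hempty n hn h m hm]
      ring
  rw [hsum, abs_neg]
  -- split the total model mass into live and empty rows
  have hsplit : ∑ n ∈ R, ∑ m ∈ C, b (m * n) =
      (∑ n ∈ R.filter (fun n => n ∈ L), ∑ m ∈ C, b (m * n)) +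
        ∑ n ∈ R.filter (fun n => n ∉ L), ∑ m ∈ C, b (m * n) :=
    (sum_filter_add_sum_filter_not R (fun n => n ∈ L) _).symm
  have hlive : ∑ n ∈ R.filter (fun n => n ∈ L), ∑ m ∈ C, b (m * n) ≤ (#L : ℝ) * ρ := by
    calc ∑ n ∈ R.filter (fun n => n ∈ L), ∑ m ∈ C, b (m * n)
        ≤ ∑ n ∈ R.filter (fun n => n ∈ L), ρ :=
          sum_le_sum fun n hn => hrow n (mem_filter.mp hn).1
      _ = (#(R.filter (fun n => n ∈ L)) : ℝ) * ρ := by rw [sum_const, nsmul_eq_mul]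
      _ ≤ (#L : ℝ) * ρ := by
          have hsub : R.filter (fun n => n ∈ L) ⊆ L := fun n hn => (mem_filter.mp hn).2
          have hcard := card_le_card hsub
          exact mul_le_mul_of_nonneg_right (by exact_mod_cast hcard) hρ
  have hnonneg : 0 ≤ ∑ n ∈ R.filter (fun n => n ∉ L), ∑ m ∈ C, b (m * n) :=
    sum_nonneg fun n hn => sum_nonneg fun m hm => hb n (mem_filter.mp hn).1 m hm
  rw [abs_of_nonneg hnonneg]
  linarith

/-! ### The Chebyshev–Hooley moduli count and its live rows -/

/-- The Chebyshev–Hooley moduli count of `ℓ² + 1` is written inline throughout: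
`c_X(k) = #((Icc 1 X).filter (k ∣ ·² + 1)) = #{1 ≤ ℓ ≤ X : k ∣ ℓ² + 1}`.
`c_X(k) ≠ 0` iff some `ℓ ∈ [1, X]` has `k ∣ ℓ² + 1`. [folklore] -/
theorem chCount_ne_zero_iff {X k : ℕ} :
    #((Icc 1 X).filter (fun ℓ : ℕ => k ∣ ℓ ^ 2 + 1)) ≠ 0 ↔ ∃ ℓ ∈ Icc 1 X, k ∣ ℓ ^ 2 + 1 := by
  rw [Ne, card_eq_zero, filter_eq_empty_iff]
  push Not
  exact Iff.rfl

/-- Above the top rung the moduli sequence vanishes: `c_X(k) = 0` for `k > X² + 1`. [folklore] -/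
theorem chCount_eq_zero_of_lt {X k : ℕ} (hk : X ^ 2 + 1 < k) :
    #((Icc 1 X).filter (fun ℓ : ℕ => k ∣ ℓ ^ 2 + 1)) = 0 := by
  by_contra h
  obtain ⟨ℓ, hℓ, hdvd⟩ := chCount_ne_zero_iff.mp h
  have hℓX : ℓ ≤ X := (mem_Icc.mp hℓ).2
  have hpos : 0 < ℓ ^ 2 + 1 := Nat.succ_pos _
  have hle : k ≤ ℓ ^ 2 + 1 := Nat.le_of_dvd hpos hdvd
  have : ℓ ^ 2 ≤ X ^ 2 := Nat.pow_le_pow_left hℓX 2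
  omega

/-- **A live row divides some `ℓ² + 1`.**  If the row `n` meets the support of `c_X` in any column
`m` (i.e. `c_X(mn) ≠ 0`), then `n ∣ ℓ² + 1` for some `1 ≤ ℓ ≤ X`, so `n` lies in the union of the
divisor sets of the `ℓ² + 1`, `ℓ ≤ X`. [folklore] -/
theorem liveRow_subset {X m n : ℕ} (h : #((Icc 1 X).filter (fun ℓ : ℕ => m * n ∣ ℓ ^ 2 + 1)) ≠ 0) :
    n ∈ (Icc 1 X).biUnion (fun ℓ : ℕ => (ℓ ^ 2 + 1).divisors) := by
  obtain ⟨ℓ, hℓ, hdvd⟩ := chCount_ne_zero_iff.mp h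
  rw [mem_biUnion]
  refine ⟨ℓ, hℓ, Nat.mem_divisors.mpr ⟨?_, Nat.succ_ne_zero _⟩⟩
  exact dvd_trans (dvd_mul_left n m) hdvd

/-- The number of live rows is at most `∑_{ℓ ≤ X} τ(ℓ² + 1)`. [folklore] -/
theorem card_liveRows_le (X : ℕ) :
    (#((Icc 1 X).biUnion (fun ℓ : ℕ => (ℓ ^ 2 + 1).divisors)) : ℝ) ≤
      ∑ ℓ ∈ Icc 1 X, (#(ℓ ^ 2 + 1).divisors : ℝ) := by
  exact_mod_cast card_biUnion_le

/-- The divisor bound makes the live-row count `≤ C_ε · X · (X² + 1)^ε`. [folklore] -/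
theorem sum_card_divisors_sq_add_one_le {ε : ℝ} (hε : 0 < ε) :
    ∃ Cε : ℝ, 1 ≤ Cε ∧ ∀ X : ℕ,
      ∑ ℓ ∈ Icc 1 X, (#(ℓ ^ 2 + 1).divisors : ℝ) ≤ Cε * X * ((X : ℝ) ^ 2 + 1) ^ ε := by
  obtain ⟨C, hC1, hC⟩ := Literature.NumberTheory.Sieve.exists_card_divisors_le_mul_rpow hε
  refine ⟨C, hC1, fun X => ?_⟩
  have hterm : ∀ ℓ ∈ Icc 1 X, (#(ℓ ^ 2 + 1).divisors : ℝ) ≤ C * ((X : ℝ) ^ 2 + 1) ^ ε := by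
    intro ℓ hℓ
    have hℓX : ℓ ≤ X := (mem_Icc.mp hℓ).2
    have h1 := hC (ℓ ^ 2 + 1) (Nat.succ_ne_zero _)
    have h2 : ((ℓ ^ 2 + 1 : ℕ) : ℝ) ≤ (X : ℝ) ^ 2 + 1 := by
      have hpow : ℓ ^ 2 ≤ X ^ 2 := Nat.pow_le_pow_left hℓX 2
      have hnat : ℓ ^ 2 + 1 ≤ X ^ 2 + 1 := Nat.add_le_add_right hpow 1
      exact_mod_cast hnat
    have h3 : (((ℓ ^ 2 + 1 : ℕ) : ℝ)) ^ ε ≤ ((X : ℝ) ^ 2 + 1) ^ ε :=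
      Real.rpow_le_rpow (by positivity) h2 hε.le
    have hC0 : 0 ≤ C := by linarith
    calc (#(ℓ ^ 2 + 1).divisors : ℝ) ≤ C * ((ℓ ^ 2 + 1 : ℕ) : ℝ) ^ ε := h1
      _ ≤ C * ((X : ℝ) ^ 2 + 1) ^ ε := mul_le_mul_of_nonneg_left h3 hC0
  have hs : ∑ ℓ ∈ Icc 1 X, (#(ℓ ^ 2 + 1).divisors : ℝ) ≤
      ∑ ℓ ∈ Icc 1 X, C * ((X : ℝ) ^ 2 + 1) ^ ε := sum_le_sum hterm
  have hc : ∑ ℓ ∈ Icc 1 X, C * ((X : ℝ) ^ 2 + 1) ^ ε =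
      (X : ℝ) * (C * ((X : ℝ) ^ 2 + 1) ^ ε) := by
    rw [sum_const, Nat.card_Icc, nsmul_eq_mul]
    norm_num
  rw [hc] at hs
  linarith

/-! ### Assembly: no cancellation beyond the live rows -/

/-- **Empty rows of the Chebyshev–Hooley moduli sequence.**  For every `X`, all finite sets of
rows `R` and columns `C`, and every model `b` non-negative on the box with row sums `≤ ρ`
(`ρ ≥ 0`), some `{0,1}`-valued row coefficient `β` (column coefficient `1`) gives
`|∑_{n ∈ R} β_n ∑_{m ∈ C} (c_X(mn) − b(mn))| ≥ ∑_{R×C} b − (∑_{ℓ ≤ X} τ(ℓ²+1)) · ρ`.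
With `R = (N,2N]`, `C = (M,2M]`, `MN = X^α` and `b(k) = X ρ(k)/k` this is
`≥ (model mass) − X^{2+o(1)}/N`: no saving over the model mass once `N ≥ X^{1+ε}`.
[folklore] -/
theorem chebyshevHooley_rows (X : ℕ) (R C : Finset ℕ) (b : ℕ → ℝ)
    (hb : ∀ n ∈ R, ∀ m ∈ C, 0 ≤ b (m * n)) {ρ : ℝ} (hρ : 0 ≤ ρ)
    (hrow : ∀ n ∈ R, ∑ m ∈ C, b (m * n) ≤ ρ) :
    ∃ β : ℕ → ℝ, (∀ n, β n = 0 ∨ β n = 1) ∧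
      (∑ n ∈ R, ∑ m ∈ C, b (m * n)) - (∑ ℓ ∈ Icc 1 X, (#(ℓ ^ 2 + 1).divisors : ℝ)) * ρ ≤
        |∑ n ∈ R, β n * ∑ m ∈ C,
          ((#((Icc 1 X).filter (fun ℓ : ℕ => m * n ∣ ℓ ^ 2 + 1)) : ℝ) - b (m * n))| := by
  set L := (Icc 1 X).biUnion (fun ℓ : ℕ => (ℓ ^ 2 + 1).divisors) with hLdef
  have hL : ∀ n ∈ R, ∀ m ∈ C,
      ((#((Icc 1 X).filter (fun ℓ : ℕ => m * n ∣ ℓ ^ 2 + 1)) : ℕ) : ℝ) ≠ 0 → n ∈ L := by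
    intro n _ m _ h
    exact liveRow_subset (X := X) (m := m) (n := n) (by exact_mod_cast h)
  obtain ⟨β, hβ, hβsum⟩ :=
    bilinear_emptyRows_lower R C L
      (fun k => ((#((Icc 1 X).filter (fun ℓ : ℕ => k ∣ ℓ ^ 2 + 1)) : ℕ) : ℝ)) b hb hρ hrow hL
  refine ⟨β, hβ, le_trans ?_ hβsum⟩
  have hcard := card_liveRows_le X
  have : (#L : ℝ) * ρ ≤ (∑ ℓ ∈ Icc 1 X, (#(ℓ ^ 2 + 1).divisors : ℝ)) * ρ :=
    mul_le_mul_of_nonneg_right hcard hρ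
  linarith

/-- The same with the roles of the variables exchanged: a `{0,1}`-valued COLUMN coefficient `α`
(row coefficient `1`) with
`|∑_{m ∈ C} α_m ∑_{n ∈ R} (c_X(mn) − b(mn))| ≥ ∑ b − (∑_{ℓ≤X} τ(ℓ²+1)) · κ` whenever the column
sums of the model are `≤ κ`.  Hence both variables of a non-trivial bilinear estimate are confined
to `≤ X^{1+o(1)}`. [folklore] -/
theorem chebyshevHooley_cols (X : ℕ) (R C : Finset ℕ) (b : ℕ → ℝ)
    (hb : ∀ n ∈ R, ∀ m ∈ C, 0 ≤ b (m * n)) {κ : ℝ} (hκ : 0 ≤ κ)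
    (hcol : ∀ m ∈ C, ∑ n ∈ R, b (m * n) ≤ κ) :
    ∃ α : ℕ → ℝ, (∀ m, α m = 0 ∨ α m = 1) ∧
      (∑ m ∈ C, ∑ n ∈ R, b (m * n)) - (∑ ℓ ∈ Icc 1 X, (#(ℓ ^ 2 + 1).divisors : ℝ)) * κ ≤
        |∑ m ∈ C, α m * ∑ n ∈ R,
          ((#((Icc 1 X).filter (fun ℓ : ℕ => m * n ∣ ℓ ^ 2 + 1)) : ℝ) - b (m * n))| := by
  have hb' : ∀ m ∈ C, ∀ n ∈ R, 0 ≤ b (n * m) := fun m hm n hn => by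
    rw [mul_comm]; exact hb n hn m hm
  have hcol' : ∀ m ∈ C, ∑ n ∈ R, b (n * m) ≤ κ := fun m hm => by
    simpa only [mul_comm] using hcol m hm
  obtain ⟨α, hα, hαsum⟩ := chebyshevHooley_rows X C R b hb' hκ hcol'
  refine ⟨α, hα, ?_⟩
  simpa only [mul_comm] using hαsum

/-- **Power form.**  For every `ε > 0` there is `C_ε ≥ 1` with: for all `X`, rows `R`, columns `C`
and models `b ≥ 0` on the box with row sums `≤ ρ` (`ρ ≥ 0`), some `{0,1}`-valued `β` has
`|∑_{n ∈ R} β_n ∑_{m ∈ C} (c_X(mn) − b(mn))| ≥ ∑_{R×C} b − C_ε X (X²+1)^ε ρ`. [folklore] -/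
theorem chebyshevHooley_rows_rpow {ε : ℝ} (hε : 0 < ε) :
    ∃ Cε : ℝ, 1 ≤ Cε ∧ ∀ (X : ℕ) (R C : Finset ℕ) (b : ℕ → ℝ),
      (∀ n ∈ R, ∀ m ∈ C, 0 ≤ b (m * n)) → ∀ {ρ : ℝ}, 0 ≤ ρ →
      (∀ n ∈ R, ∑ m ∈ C, b (m * n) ≤ ρ) →
      ∃ β : ℕ → ℝ, (∀ n, β n = 0 ∨ β n = 1) ∧
        (∑ n ∈ R, ∑ m ∈ C, b (m * n)) - Cε * X * ((X : ℝ) ^ 2 + 1) ^ ε * ρ ≤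
          |∑ n ∈ R, β n * ∑ m ∈ C,
            ((#((Icc 1 X).filter (fun ℓ : ℕ => m * n ∣ ℓ ^ 2 + 1)) : ℝ) - b (m * n))| := by
  obtain ⟨Cε, hC1, hC⟩ := sum_card_divisors_sq_add_one_le hε
  refine ⟨Cε, hC1, fun X R C b hb ρ hρ hrow => ?_⟩
  obtain ⟨β, hβ, hsum⟩ := chebyshevHooley_rows X R C b hb hρ hrow
  refine ⟨β, hβ, le_trans ?_ hsum⟩
  have := mul_le_mul_of_nonneg_right (hC X) hρ
  linarith

end Summit.Parity.BatemanHorn.Theorems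

end
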